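import Summits.CriticalPhenomena.PercolationContinuityZ3.Theorems.SahiMasterFamilyHeredity

/-!
# (T-a): a coordinate pivotal for all three events makes `E_3` non-vanishing

Companion of `SahiMasterFamilyHeredity.lean` (crux `NoHeavyLowerTail`, stmt-CriticalPhenomena-4575; unit `prim-master-conj`).
There, the identically-zero form of the master equality conjecture at order 3 was reduced to
`SahiE3NonvanishingOfPairwiseDependent` ((T): three increasing events every two of which share an essential
coordinate have `E_3(μ_p) ≠ 0` for SOME interior `p`).  This file PROVES the first case of (T):

* `sahiE_three_update_eq` — varying one coordinate: with `q_s = p[e ↦ s]`,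
  `E_3(μ_{q_s}; F) = Φ(s)`, an explicit cubic in `s` whose coefficients are "section moments" off `e`;
* `sahiE3_ne_zero_of_common_pivotal` — if `e` is pivotal for each of the three increasing events `U_0,U_1,U_2`
  (some `ω ∌ e` with `ω ∉ U_j ∋ ω ∪ {e}`), then for every interior `p` some `s ∈ {1/5,2/5,3/5,4/5}` has
  `E_3(μ_{p[e↦s]}; 1_U) ≠ 0`: the `s³`-coefficient of `Φ` is the product of the three influences
  `I_e(U_j) = μ(U_j^{e←1}) − μ(U_j^{e←0}) > 0`, and a cubic vanishing at four points has zero leading coefficient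
  (third finite difference);
* `sahiE3Nonvanishing_of_common_pivotal` — hence such triples satisfy the conclusion of (T).
So (T) is reduced to triples whose three supports pairwise intersect but have EMPTY common intersection
(MASTER-FAMILY.md §MASTER UPDATE 3, items (T-b)–(T-d)). Everything here is proved; axioms standard. [this work]
-/

noncomputable section

open scoped Classical

namespace Summit.CriticalPhenomena.PercolationContinuityZ3.Theorems

open Finset Function MeasureTheory
open Literature.Combinatorics.Sahi2008
open Literature.Probability.Percolation (DeterminedBy)
open Literature.Probability.Percolation.DecisionTree (ind ind_of_mem ind_of_not_mem ind_nonneg)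

section OneCoordinate

variable {ι : Type*} [Fintype ι]

/-- The product weight OFF the coordinate `e`: `R_e(ω) = ∏_{i ≠ e} (p_i if i ∈ ω else 1 − p_i)`. [folklore] -/
def offWeight (p : ι → unitInterval) (e : ι) (ω : Set ι) : ℝ :=
  ∏ i ∈ univ.erase e, (if i ∈ ω then ((p i : ℝ)) else 1 - (p i : ℝ))

/-- `R_e` is positive in the open cube. [folklore] -/
theorem offWeight_pos {p : ι → unitInterval} (hp : ∀ i, (p i : ℝ) ∈ Set.Ioo (0 : ℝ) 1) (e : ι) (ω : Set ι) :
    0 < offWeight p e ω := by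
  unfold offWeight
  exact prod_pos fun i _ => by
    split_ifs
    · exact (hp i).1
    · exact sub_pos.2 (hp i).2

/-- `R_e` is nonnegative. [folklore] -/
theorem offWeight_nonneg (p : ι → unitInterval) (e : ι) (ω : Set ι) : 0 ≤ offWeight p e ω := by
  unfold offWeight
  exact prod_nonneg fun i _ => by
    split_ifs
    · exact (p i).2.1
    · exact sub_nonneg.2 (p i).2.2

/-- The weight with `p_e` replaced by `s`, at `insert e ω` and at `ω ∌ e`. [folklore] -/
theorem bernoulliWeight_update (p : ι → unitInterval) (e : ι) (s : unitInterval) {ω : Set ι} (hω : e ∉ ω) :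
    bernoulliWeight (update p e s) (insert e ω) = (s : ℝ) * offWeight p e ω ∧
      bernoulliWeight (update p e s) ω = (1 - (s : ℝ)) * offWeight p e ω := by
  simp only [bernoulliWeight, Literature.Probability.Percolation.BHK2006.weight, offWeight]
  constructor
  · rw [← mul_prod_erase univ _ (mem_univ e)]
    simp only [Set.mem_insert_iff, true_or, if_true, update_self]
    congr 1
    refine prod_congr rfl fun i hi => ?_
    have hie : i ≠ e := ne_of_mem_erase hi
    simp only [hie, false_or, update_of_ne hie]
  · rw [← mul_prod_erase univ _ (mem_univ e)]
    simp only [hω, if_false, update_self]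
    congr 1
    refine prod_congr rfl fun i hi => ?_
    have hie : i ≠ e := ne_of_mem_erase hi
    simp only [update_of_ne hie]

/-- Section moment off `e`: `Σ_{ω ∌ e} R_e(ω) h(ω ∪ {e})` (`b = true`) or `Σ_{ω ∌ e} R_e(ω) h(ω)` (`b = false`). [this work] -/
def secEx (p : ι → unitInterval) (e : ι) (h : Set ι → ℝ) (b : Bool) : ℝ :=
  ∑ ω ∈ univ.filter (fun ω : Set ι => e ∉ ω), offWeight p e ω * h (if b then insert e ω else ω)

/-- **Expectation with one coordinate varied**: `E_{p[e↦s]}(h) = s·X₁(h) + (1−s)·X₀(h)` with the section moments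
`X_b(h) = secEx p e h b` (independent of `s`). [this work] -/
theorem ex_update_eq (p : ι → unitInterval) (e : ι) (s : unitInterval) (h : Set ι → ℝ) :
    ex (bernoulliWeight (update p e s)) h = (s : ℝ) * secEx p e h true + (1 - (s : ℝ)) * secEx p e h false := by
  simp only [ex, secEx]
  rw [sum_conf_split e, mul_sum, mul_sum, ← sum_add_distrib]
  refine sum_congr rfl fun ω hω => ?_
  simp only [mem_filter, mem_univ, true_and] at hω
  obtain ⟨h1, h0⟩ := bernoulliWeight_update p e s hω
  rw [h1, h0]
  simp only [Bool.false_eq_true, if_false, if_true]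
  ring

/-- The cubic `Φ(s)` giving `E_3(μ_{p[e↦s]}; f,g,h)`: Sahi's closed form with every moment replaced by
`s·X₁ + (1−s)·X₀`. [this work] -/
def cubicE3 (p : ι → unitInterval) (e : ι) (f g h : Set ι → ℝ) (s : ℝ) : ℝ :=
  let M : (Set ι → ℝ) → ℝ := fun k => s * secEx p e k true + (1 - s) * secEx p e k false
  2 * M (f * g * h) + M f * M g * M h - (M f * M (g * h) + M g * M (f * h) + M h * M (f * g))

/-- **`E_3` with one coordinate varied is the cubic `Φ`.** [this work] -/
theorem sahiE_three_update_eq (p : ι → unitInterval) (e : ι) (s : unitInterval) (f g h : Set ι → ℝ) :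
    sahiE (bernoulliWeight (update p e s)) 3 ![f, g, h] = cubicE3 p e f g h (s : ℝ) := by
  rw [sahiE_three]
  simp only [ex_update_eq, cubicE3]

/-- **Third finite difference of the cubic**: `Φ(4t) − 3Φ(3t) + 3Φ(2t) − Φ(t) = 6t³·c₃` with
`c₃ = (X₁f − X₀f)(X₁g − X₀g)(X₁h − X₀h)` the product of the three "influences". [folklore] -/
theorem cubicE3_third_difference (p : ι → unitInterval) (e : ι) (f g h : Set ι → ℝ) (t : ℝ) :
    cubicE3 p e f g h (4 * t) - 3 * cubicE3 p e f g h (3 * t) + 3 * cubicE3 p e f g h (2 * t) -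
        cubicE3 p e f g h t =
      6 * t ^ 3 * ((secEx p e f true - secEx p e f false) * (secEx p e g true - secEx p e g false) *
        (secEx p e h true - secEx p e h false)) := by
  simp only [cubicE3]
  ring

/-- **The influence of a pivotal coordinate is positive**: for an increasing event `A` and `e` pivotal for `A`
(some `ω ∌ e`, `ω ∉ A`, `ω ∪ {e} ∈ A`), `X₁(1_A) − X₀(1_A) > 0` in the open cube. [this work] -/
theorem secEx_ind_sub_pos {p : ι → unitInterval} (hp : ∀ i, (p i : ℝ) ∈ Set.Ioo (0 : ℝ) 1) (e : ι)
    {A : Set (Set ι)} (hA : IsUpperSet A) (he : ∃ ω, e ∉ ω ∧ ω ∉ A ∧ insert e ω ∈ A) :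
    0 < secEx p e (ind A) true - secEx p e (ind A) false := by
  obtain ⟨ω₀, he₀, hout, hin⟩ := he
  simp only [secEx, Bool.false_eq_true, if_false, if_true]
  rw [← sum_sub_distrib]
  have hterm : ∀ ω ∈ univ.filter (fun ω : Set ι => e ∉ ω),
      0 ≤ offWeight p e ω * ind A (insert e ω) - offWeight p e ω * ind A ω := by
    intro ω _
    rw [← mul_sub]
    refine mul_nonneg (offWeight_nonneg p e ω) (sub_nonneg.2 ?_)
    exact monotone_ind_of_isUpperSet hA (Set.subset_insert e ω)
  refine lt_of_lt_of_le ?_ (single_le_sum hterm (by simp [he₀] : ω₀ ∈ univ.filter (fun ω : Set ι => e ∉ ω)))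
  rw [ind_of_mem hin, ind_of_not_mem hout, mul_one, mul_zero, sub_zero]
  exact offWeight_pos hp e ω₀

/-- Rational points `k/5`, `k = 1,…,4`, of the unit interval. [folklore] -/
def fifth (k : ℕ) (hk : k ≤ 5) : unitInterval :=
  ⟨(k : ℝ) / 5, by positivity, by
    rw [div_le_one (by norm_num)]; exact_mod_cast hk⟩

/-- **(T-a) Common pivotal coordinate ⇒ `E_3` does not vanish identically**: if `e` is pivotal for each of three
increasing events, then for every interior `p` one of the four interior parameter vectors `p[e ↦ k/5]`,
`k = 1,…,4`, has `E_3(μ; 1_{U_0},1_{U_1},1_{U_2}) ≠ 0` (the `s³`-coefficient of `s ↦ E_3(μ_{p[e↦s]})` is the product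
of the three influences, which is positive). [this work] -/
theorem sahiE3_ne_zero_of_common_pivotal {p : ι → unitInterval} (hp : ∀ i, (p i : ℝ) ∈ Set.Ioo (0 : ℝ) 1)
    (U : Fin 3 → Set (Set ι)) (hU : ∀ j, IsUpperSet (U j)) (e : ι)
    (he : ∀ j, ∃ ω, e ∉ ω ∧ ω ∉ U j ∧ insert e ω ∈ U j) :
    ∃ k : ℕ, ∃ hk : 1 ≤ k ∧ k ≤ 4,
      sahiE (bernoulliWeight (update p e (fifth k (by omega)))) 3 (fun j => ind (U j)) ≠ 0 := by
  by_contra hall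
  push Not at hall
  have hF : (fun j => ind (U j)) = ![ind (U 0), ind (U 1), ind (U 2)] := by
    funext j; fin_cases j <;> rfl
  have hΦ : ∀ k : ℕ, ∀ hk : 1 ≤ k ∧ k ≤ 4, cubicE3 p e (ind (U 0)) (ind (U 1)) (ind (U 2)) ((k : ℝ) / 5) = 0 := by
    intro k hk
    have h := hall k hk
    rw [hF, sahiE_three_update_eq] at h
    exact h
  have h1 := hΦ 1 ⟨le_rfl, by norm_num⟩
  have h2 := hΦ 2 ⟨by norm_num, by norm_num⟩
  have h3 := hΦ 3 ⟨by norm_num, by norm_num⟩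
  have h4 := hΦ 4 ⟨by norm_num, le_rfl⟩
  have hd := cubicE3_third_difference p e (ind (U 0)) (ind (U 1)) (ind (U 2)) ((1 : ℝ) / 5)
  have e4 : (4 : ℝ) * (1 / 5) = ((4 : ℕ) : ℝ) / 5 := by norm_num
  have e3 : (3 : ℝ) * (1 / 5) = ((3 : ℕ) : ℝ) / 5 := by norm_num
  have e2 : (2 : ℝ) * (1 / 5) = ((2 : ℕ) : ℝ) / 5 := by norm_num
  have e1 : (1 : ℝ) / 5 = ((1 : ℕ) : ℝ) / 5 := by norm_num
  rw [e4, e3, e2, h4, h3, h2] at hd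
  rw [e1, h1] at hd
  have hpos : 0 < (secEx p e (ind (U 0)) true - secEx p e (ind (U 0)) false) *
      (secEx p e (ind (U 1)) true - secEx p e (ind (U 1)) false) *
      (secEx p e (ind (U 2)) true - secEx p e (ind (U 2)) false) :=
    mul_pos (mul_pos (secEx_ind_sub_pos hp e (hU 0) (he 0)) (secEx_ind_sub_pos hp e (hU 1) (he 1)))
      (secEx_ind_sub_pos hp e (hU 2) (he 2))
  have : (6 : ℝ) * (((1 : ℕ) : ℝ) / 5) ^ 3 * ((secEx p e (ind (U 0)) true - secEx p e (ind (U 0)) false) *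
      (secEx p e (ind (U 1)) true - secEx p e (ind (U 1)) false) *
      (secEx p e (ind (U 2)) true - secEx p e (ind (U 2)) false)) = 0 := by
    rw [← hd]; ring
  have h6 : (0 : ℝ) < 6 * (((1 : ℕ) : ℝ) / 5) ^ 3 := by norm_num
  exact (mul_pos h6 hpos).ne' this

omit [Fintype ι] in
/-- The updated parameter vector stays in the open cube. [folklore] -/
theorem update_fifth_mem_Ioo {p : ι → unitInterval} (hp : ∀ i, (p i : ℝ) ∈ Set.Ioo (0 : ℝ) 1) (e : ι)
    {k : ℕ} (hk : 1 ≤ k ∧ k ≤ 4) (i : ι) :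
    ((update p e (fifth k (by omega)) i : unitInterval) : ℝ) ∈ Set.Ioo (0 : ℝ) 1 := by
  by_cases hi : i = e
  · subst hi
    rw [update_self]
    simp only [fifth, Set.mem_Ioo]
    obtain ⟨h1, h4⟩ := hk
    constructor
    · have : (1 : ℝ) ≤ k := by exact_mod_cast h1
      positivity
    · have : (k : ℝ) ≤ 4 := by exact_mod_cast h4
      linarith
  · rw [update_of_ne hi]; exact hp i

end OneCoordinate

/-- **(T) holds for triples with a common pivotal coordinate**: three increasing events on a finite `ι` with a
coordinate pivotal for all three have `E_3(μ_p; 1_U) ≠ 0` at some interior `p` — the case of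
`SahiE3NonvanishingOfPairwiseDependent` in which the three essential supports have a common point.  (What remains
of (T): supports pairwise intersecting with empty triple intersection.) [this work] -/
theorem sahiE3Nonvanishing_of_common_pivotal {ι : Type} [Fintype ι] (U : Fin 3 → Set (Set ι))
    (hU : ∀ j, IsUpperSet (U j)) (e : ι) (he : ∀ j, ∃ ω, e ∉ ω ∧ ω ∉ U j ∧ insert e ω ∈ U j) :
    ∃ p : ι → unitInterval, (∀ i, (p i : ℝ) ∈ Set.Ioo (0 : ℝ) 1) ∧
      sahiE (bernoulliWeight p) 3 (fun j => ind (U j)) ≠ 0 := by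
  obtain ⟨k, hk, hne⟩ := sahiE3_ne_zero_of_common_pivotal (halfParams_mem_Ioo ι) U hU e he
  exact ⟨_, update_fifth_mem_Ioo (halfParams_mem_Ioo ι) e hk, hne⟩

end Summit.CriticalPhenomena.PercolationContinuityZ3.Theorems
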